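import Literature.Analysis.FluidPDE.SwirlMaximumPrinciple
import HarnessLib

/-!
# The maximum principle for the swirl `Γ = r u_θ` of axisymmetric Navier–Stokes flows WITH A FORCE

Analysis/FluidPDE proof file (no definitions, no named facts, no `sorry`).  Companion of
`SwirlMaximumPrinciple.lean` (the unforced maximum principle (1.4) of Lei–Zhang 2017 /
Koch–Nadirashvili–Seregin–Šverák 2009 (1.9), `abs_swirl_le_of_classical`).  For a classical
solution of the FORCED system `∂ₜu + (u·∇)u = νΔu − ∇p + f`, `div u = 0` with axisymmetric velocity
AND axisymmetric force, the swirl `Γ = r u_θ = x₀u₁ − x₁u₀` satisfies off the axis (the tree's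
`swirl_transport_holds`, KNSS 2009 (1.8) with the forcing term kept)

  `∂ₜΓ + u·∇Γ = ν(ΔΓ − (2/r)∂ᵣΓ) + r f_θ`,   `r f_θ = swirl f`,

and the same elementary comparison argument as in the unforced file gives the linear-in-time
bound

* `sign_mul_swirl_le_of_classical_forced`, **`abs_swirl_le_of_classical_forced`** — for `ν ≥ 0`, a
  classical solution on the closed slab `[0, T] × ℝ³` with bounded (`|u| ≤ V`) axisymmetric velocity,
  axisymmetric force with bounded swirl `|r f_θ(t, x)| ≤ F`, and `|Γ₀| ≤ M`:
  `|Γ(t, x)| ≤ M + F t` on `[0, T] × ℝ³`;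
* `abs_swirl_le_of_classical_forced_Ico` — the same on a half-open lifespan `[0, T)` for a solution
  bounded on every closed sub-slab (from the closed-slab statement on `[0, (t+T)/2]`).

This is the viscous, forced form of Kelvin's theorem for the azimuthal circulation on material
circles centred on the axis: the circulation is bounded by its initial supremum plus the
time-integrated supremum of the azimuthal torque `r f_θ` of the force; viscosity only helps
(`ν ≥ 0` enters through `νσΔΓ ≤ 6νc` and `(2ν/r)∂ᵣh ≥ 0` exactly as in the unforced proof).

## The comparison argument (as in `SwirlMaximumPrinciple.lean`, one extra term)

Barrier `h(t, x) = M + F t + c(1 + |x|²)`, `c = ε e^{βt}`, `β = 6ν + V + 1`; `w = σΓ − h`, `σ = ±1`.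
At a point of `U = B(0, R) ∖ {axis}` with `∇w = 0`, `Δw ≤ 0`: `σ∇Γ = ∇h = 2c⟪x, ·⟫`, `σΔΓ ≤ 6c`,
so by the forced swirl equation
`σΓₜ = νσΔΓ − (2ν/r)∂ᵣh − ∇h·u + σ r f_θ ≤ 6νc + 2cV|x| + F < F + βc(1 + |x|²) = hₜ`, i.e.
`wₜ < 0`; on the parabolic boundary `w ≤ 0` (`|Γ₀| ≤ M` at `t = 0`; `Γ = 0` on the axis;
`|Γ| ≤ 2|x||u| ≤ 2RV ≤ ε(1 + R²)` on `|x| = R ≥ 2V/ε`; and `F t ≥ 0`).  Hence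
`σΓ ≤ M + F t + ε e^{βt}(1 + |x|²)` on every large ball for every `ε > 0`, whence `σΓ ≤ M + F t`.

## Tree search

`lean search 'swirl \(f |F \* t|abs_swirl_le.*forced'` — no forced maximum principle in the tree;
`swirl_transport_holds` (SwirlTransportProofs) is stated WITH the force;
`IsClassicalNSSolutionOn.isAxisymmetricScalar_pressure` takes an axisymmetric force;
`weak_max_principle`, `hasFDerivAt_barrier`, `laplacian_barrier`, `contDiff_barrier`,
`inner_self_eR_nonneg`, `abs_swirl_le_norm_mul`, `swirl_eq_zero_of_cylRadius_eq_zero` reused verbatim.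

WHAT THIS IS NOT: not a statement about Navier–Stokes blow-up — an a priori bound for classical
forced axisymmetric solutions (cell `pub/ns-blowup`, seat `ns-blowup-ecbridge-2` g8: the input of
the E–C row «the azimuthal circulation of an axisymmetric Clay blow-up is bounded up to the
blow-up time», `Summits/…/FluidComputer/ClayBlowupSwirlBound.lean`).

## References

* G. Koch, N. Nadirashvili, G. Seregin, V. Šverák, Acta Math. 203 (2009) = arXiv:0709.3599, §1,
  (1.8)–(1.9) (the equation for `r u_θ` and its maximum principle). [`KochNadirashviliSereginSverak2009`]
* Z. Lei, Q. S. Zhang, Pacific J. Math. 289 (2017), arXiv:1505.02628, §1 (1.3)–(1.4). [`LeiZhang2017`]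
* D. Chae, J. Lee, Math. Z. 239 (2002), §1. [`ChaeLee2002`]
* G. M. Lieberman, *Second order parabolic differential equations*, World Scientific 1996,
  Ch. II, Lemma 2.1, Lemma 2.3. [`Lieberman1996`]
-/

noncomputable section

open MeasureTheory Set Function Filter Topology Metric InnerProductSpace WithLp
open scoped RealInnerProductSpace Laplacian ContDiff NNReal

namespace Literature.Analysis.FluidPDE

section SwirlForced

/-- **One-sided comparison for the swirl, forced system, any `ν ≥ 0`.**  For a classical solution
`(v, q)` of the Navier–Stokes/Euler system with force `f` and viscosity `ν ≥ 0` on `[0, T] × ℝ³`,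
with bounded (`|v| ≤ V`) axisymmetric velocity, axisymmetric force whose swirl is bounded
(`|r f_θ(t, x)| = |swirl (f t) x| ≤ F`), and `|Γ₀| ≤ M`: for a sign `σ = ±1`,
`σ Γ(t, x) ≤ M + F t` on `[0, T] × ℝ³`.  The comparison argument of the unforced
`sign_mul_swirl_le_of_classical_of_nonneg` with the barrier `M + F t + ε e^{βt}(1 + |x|²)`; the swirl
equation with force is the tree's `swirl_transport_holds` (KNSS (1.8) with the term `r f_θ` kept).
[cite: KochNadirashviliSereginSverak2009, §1 (1.8)–(1.9) (arXiv p. 2)] -/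
theorem sign_mul_swirl_le_of_classical_forced {T ν V M F : ℝ}
    {v f : ℝ → (EuclideanSpace ℝ (Fin 3)) → (EuclideanSpace ℝ (Fin 3))}
    {q : ℝ → (EuclideanSpace ℝ (Fin 3)) → ℝ}
    (hν : 0 ≤ ν) (hT : 0 < T) (hcl : IsClassicalNSSolutionOn (Icc 0 T) ν f v q)
    (haxi : ∀ t ∈ Icc 0 T, IsAxisymmetric (v t)) (hfaxi : ∀ t ∈ Icc 0 T, IsAxisymmetric (f t))
    (hV : ∀ t ∈ Icc 0 T, ∀ x, ‖v t x‖ ≤ V) (hM : ∀ x, |swirl (v 0) x| ≤ M)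
    (hF : ∀ t ∈ Icc 0 T, ∀ x, |swirl (f t) x| ≤ F) {σ : ℝ} (hσ : σ = 1 ∨ σ = -1) :
    ∀ t ∈ Icc 0 T, ∀ x, σ * swirl (v t) x ≤ M + F * t := by
  have hV0 : 0 ≤ V := (norm_nonneg _).trans (hV 0 ⟨le_rfl, hT.le⟩ 0)
  have hF0 : 0 ≤ F := (abs_nonneg _).trans (hF 0 ⟨le_rfl, hT.le⟩ 0)
  have hσabs : ∀ a : ℝ, σ * a ≤ |a| := fun a => by
    rcases hσ with h | h
    · rw [h, one_mul]; exact le_abs_self a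
    · rw [h, neg_one_mul]; exact neg_le_abs a
  -- the pressure is axisymmetric, so the swirl equation holds off the axis
  have hp : ∀ t ∈ Icc 0 T, IsAxisymmetricScalar (q t) := fun t ht =>
    hcl.isAxisymmetricScalar_pressure (uniqueDiffOn_Icc hT) haxi hfaxi ht
  -- constants of the barrier
  set β : ℝ := 6 * ν + V + 1 with hβ
  have hβ0 : 0 ≤ β := by rw [hβ]; positivity
  -- the claim for every `ε > 0`, on every large ball
  suffices key : ∀ ε : ℝ, 0 < ε → ∀ R : ℝ, 2 * V / ε ≤ R →
      ∀ t ∈ Icc 0 T, ∀ x ∈ closedBall (0 : (EuclideanSpace ℝ (Fin 3))) R,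
        σ * swirl (v t) x - (M + F * t + ε * Real.exp (β * t) * (1 + ‖x‖ ^ 2)) ≤ 0 by
    intro t ht x
    refine le_of_forall_pos_le_add fun η hη => ?_
    set C : ℝ := Real.exp (β * t) * (1 + ‖x‖ ^ 2) with hC
    have hCpos : 0 < C := by positivity
    have h := key (η / C) (div_pos hη hCpos) (max (2 * V / (η / C)) ‖x‖) (le_max_left _ _) t ht x
      (mem_closedBall_zero_iff.2 (le_max_right _ _))
    have e : η / C * Real.exp (β * t) * (1 + ‖x‖ ^ 2) = η := by
      rw [hC]; field_simp
    rw [e] at h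
    linarith
  intro ε hε R hR
  have hR0 : 0 ≤ R := le_trans (by positivity) hR
  -- the comparison function
  set w : ℝ → (EuclideanSpace ℝ (Fin 3)) → ℝ := fun t x =>
    σ * swirl (v t) x - (M + F * t + ε * Real.exp (β * t) * (1 + ‖x‖ ^ 2)) with hw
  set Γₜ : ℝ → (EuclideanSpace ℝ (Fin 3)) → ℝ := fun t x =>
    timeDerivWithin (Icc 0 T) (fun s => swirl (v s)) t x with hΓₜ
  set wₜ : ℝ → (EuclideanSpace ℝ (Fin 3)) → ℝ := fun t x =>
    σ * Γₜ t x - (F + β * (ε * Real.exp (β * t) * (1 + ‖x‖ ^ 2))) with hwₜ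
  set K : Set (EuclideanSpace ℝ (Fin 3)) := closedBall 0 R with hK
  set U : Set (EuclideanSpace ℝ (Fin 3)) := ball 0 R ∩ {x | cylRadius x ≠ 0} with hU
  have hKc : IsCompact K := isCompact_closedBall _ _
  have hUo : IsOpen U := isOpen_ball.inter (isOpen_ne_fun continuous_cylRadius continuous_const)
  have hUK : U ⊆ K := fun x hx => ball_subset_closedBall hx.1
  -- regularity of the velocity
  have hsm := hcl.smooth_velocity
  have hvC2 : ∀ t ∈ Icc 0 T, ContDiff ℝ 2 (v t) := fun t ht =>
    (hcl.contDiff_velocity ht).of_le (by norm_cast)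
  have hvd : ∀ t ∈ Icc 0 T, ∀ x, DifferentiableAt ℝ (v t) x := fun t ht x =>
    ((hvC2 t ht).of_le one_le_two).differentiable one_ne_zero x
  -- (a) joint continuity
  have hc : ContinuousOn (uncurry w) (Icc 0 T ×ˢ K) := by
    have hvc : ContinuousOn (uncurry v) (Icc 0 T ×ˢ K) :=
      hsm.continuousOn.mono (prod_mono Subset.rfl (subset_univ _))
    have h1 : ContinuousOn (fun p : ℝ × (EuclideanSpace ℝ (Fin 3)) => ⟪rotGenL p.2, uncurry v p⟫)
        (Icc 0 T ×ˢ K) :=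
      (rotGenL.continuous.comp continuous_snd).continuousOn.inner hvc
    have h2 : Continuous fun p : ℝ × (EuclideanSpace ℝ (Fin 3)) =>
        M + F * p.1 + ε * Real.exp (β * p.1) * (1 + ‖p.2‖ ^ 2) := by
      fun_prop
    refine (((continuousOn_const (c := σ)).mul h1).sub h2.continuousOn).congr fun p _ => ?_
    simp only [hw, uncurry, rotGenL_apply, swirl_eq_inner_rotGen, Pi.sub_apply, Pi.mul_apply]
  -- (b) smooth slices
  have h2 : ∀ t ∈ Ioc 0 T, ContDiff ℝ 2 (w t) := fun t ht =>
    (contDiff_const.mul (contDiff_swirl (hvC2 t ⟨ht.1.le, ht.2⟩))).sub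
      (contDiff_barrier (M + F * t) (ε * Real.exp (β * t)))
  -- (c) the left time derivative
  have ht : ∀ t ∈ Ioc 0 T, ∀ x ∈ U, HasDerivWithinAt (fun s => w s x) (wₜ t x) (Icc 0 t) t := by
    intro t ht x _
    have htI : t ∈ Icc 0 T := ⟨ht.1.le, ht.2⟩
    have hΓ : HasDerivWithinAt (fun s => swirl (v s) x) (Γₜ t x) (Icc 0 T) t := by
      have hd : DifferentiableWithinAt ℝ (fun s => swirl (v s) x) (Icc 0 T) t := by
        have h1 := hsm.differentiableWithinAt_time htI x
        simp only [swirl_eq_inner_rotGen]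
        exact (differentiableWithinAt_const _).inner ℝ h1
      have := hd.hasDerivWithinAt
      simp only [hΓₜ, timeDerivWithin_apply]
      exact this
    have hexp : HasDerivWithinAt (fun s => M + F * s + ε * Real.exp (β * s) * (1 + ‖x‖ ^ 2))
        (F + ε * (Real.exp (β * t) * β) * (1 + ‖x‖ ^ 2)) (Icc 0 T) t := by
      have h1 : HasDerivAt (fun s => Real.exp (β * s)) (Real.exp (β * t) * β) t := by
        have := ((hasDerivAt_id t).const_mul β).exp
        simpa using this
      have h0 : HasDerivAt (fun s : ℝ => M + F * s) F t := by
        have := ((hasDerivAt_id t).const_mul F).const_add M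
        simpa using this
      exact (h0.add ((h1.const_mul ε).mul_const (1 + ‖x‖ ^ 2))).hasDerivWithinAt
    have h := ((hΓ.const_mul σ).sub hexp).mono (Icc_subset_Icc_right ht.2)
    simp only [hw, hwₜ]
    exact h.congr_deriv (by ring)
  -- (d) the sub-solution implication, from the forced swirl equation
  have hsub : ∀ t ∈ Ioc 0 T, ∀ x ∈ U, fderiv ℝ (w t) x = 0 → (Δ (w t)) x ≤ 0 → wₜ t x ≤ 0 := by
    intro t ht x hx hgrad hlap
    have htI : t ∈ Icc 0 T := ⟨ht.1.le, ht.2⟩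
    have hr : cylRadius x ≠ 0 := hx.2
    have hr0 : 0 < cylRadius x := lt_of_le_of_ne (cylRadius_nonneg x) (Ne.symm hr)
    set c : ℝ := ε * Real.exp (β * t) with hc
    have hc0 : 0 < c := by positivity
    -- the swirl equation at `(t, x)`, with the force
    have hpde := swirl_transport_holds hcl haxi hp htI hr
    rw [convect_apply, partialDeriv_apply] at hpde
    -- derivatives of the two parts of `w t`
    have hΓd : DifferentiableAt ℝ (swirl (v t)) x := differentiableAt_swirl (hvd t htI x)
    have hB := hasFDerivAt_barrier (M + F * t) c x
    have hwderiv : HasFDerivAt (w t) (σ • fderiv ℝ (swirl (v t)) x -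
        c • ((2 : ℕ) • (innerSL ℝ x : (EuclideanSpace ℝ (Fin 3)) →L[ℝ] ℝ))) x := by
      have h := (hΓd.hasFDerivAt.const_mul σ).sub hB
      simp only [hw, hc]
      exact h
    have hDeq : σ • fderiv ℝ (swirl (v t)) x =
        c • ((2 : ℕ) • (innerSL ℝ x : (EuclideanSpace ℝ (Fin 3)) →L[ℝ] ℝ)) := by
      have := hwderiv.fderiv
      rw [hgrad] at this
      exact (sub_eq_zero.1 this.symm)
    have hDapply : ∀ a : (EuclideanSpace ℝ (Fin 3)),
        σ * fderiv ℝ (swirl (v t)) x a = c * (2 * ⟪x, a⟫) := fun a => by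
      have := congrArg (fun L : (EuclideanSpace ℝ (Fin 3)) →L[ℝ] ℝ => L a) hDeq
      simpa [innerSL_apply_apply, nsmul_eq_mul] using this
    -- Laplacians
    have hΔeq : (Δ (w t)) x = σ * (Δ (swirl (v t))) x - 6 * c := by
      have h1 : ContDiffAt ℝ 2 (fun y => σ * swirl (v t) y) x :=
        (contDiff_const.mul (contDiff_swirl (hvC2 t htI))).contDiffAt
      have h2 : ContDiffAt ℝ 2
          (fun y : (EuclideanSpace ℝ (Fin 3)) => (M + F * t + c * (1 + ‖y‖ ^ 2) : ℝ)) x :=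
        (contDiff_barrier (M + F * t) c).contDiffAt
      have h3 : (Δ (fun y => σ * swirl (v t) y)) x = σ * (Δ (swirl (v t))) x := by
        have : (fun y => σ * swirl (v t) y) = σ • swirl (v t) := by
          funext y; simp [smul_eq_mul]
        rw [this, laplacian_smul σ ((contDiff_swirl (hvC2 t htI)).contDiffAt), smul_eq_mul]
      have h4 := h1.laplacian_sub h2
      have hfun : w t = (fun y => σ * swirl (v t) y) -
          fun y : (EuclideanSpace ℝ (Fin 3)) => (M + F * t + c * (1 + ‖y‖ ^ 2) : ℝ) := by
        funext y
        simp only [hw, hc, Pi.sub_apply]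
      rw [hfun, h4, h3, laplacian_barrier]
    have hΔ : σ * (Δ (swirl (v t))) x ≤ 6 * c := by
      rw [hΔeq] at hlap; linarith
    -- the drift terms at the critical point
    have hconv : -(c * (2 * ⟪x, v t x⟫)) ≤ c * (2 * (‖x‖ * V)) := by
      have h1 : |⟪x, v t x⟫| ≤ ‖x‖ * ‖v t x‖ := abs_real_inner_le_norm _ _
      have h2 : ‖x‖ * ‖v t x‖ ≤ ‖x‖ * V := mul_le_mul_of_nonneg_left (hV t htI x) (norm_nonneg _)
      have h3 := (abs_le.1 (h1.trans h2)).1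
      nlinarith
    -- the force term
    have hforce : σ * swirl (f t) x ≤ F := (hσabs _).trans (hF t htI x)
    -- `σ Γₜ ≤ 6 ν c + 2 c V |x| + F`
    have hΓeq : Γₜ t x = ν * ((Δ (swirl (v t))) x -
        2 / cylRadius x * fderiv ℝ (swirl (v t)) x (eR x)) -
        fderiv ℝ (swirl (v t)) x (v t x) + swirl (f t) x := by
      have := eq_sub_of_add_eq hpde
      simp only [hΓₜ]
      rw [this]
      ring
    have hΓt : σ * Γₜ t x ≤ ν * (6 * c) + c * (2 * (‖x‖ * V)) + F := by
      have e : σ * Γₜ t x = ν * (σ * (Δ (swirl (v t))) x) -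
          ν * (2 / cylRadius x) * (σ * fderiv ℝ (swirl (v t)) x (eR x)) -
          σ * fderiv ℝ (swirl (v t)) x (v t x) + σ * swirl (f t) x := by
        rw [hΓeq]; ring
      rw [e, hDapply (eR x), hDapply (v t x)]
      have h1 : ν * (σ * (Δ (swirl (v t))) x) ≤ ν * (6 * c) :=
        mul_le_mul_of_nonneg_left hΔ hν
      have h2 : 0 ≤ ν * (2 / cylRadius x) * (c * (2 * ⟪x, eR x⟫)) := by
        have := inner_self_eR_nonneg x
        positivity
      linarith
    -- conclude: `wₜ ≤ (6ν + V - β) c (1 + |x|²) ≤ 0`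
    set A : ℝ := c * (1 + ‖x‖ ^ 2) with hA
    have hA0 : 0 ≤ A := by positivity
    have hx2 : 2 * (‖x‖ * V) ≤ V * (1 + ‖x‖ ^ 2) := by
      nlinarith [sq_nonneg (‖x‖ - 1), norm_nonneg x]
    have hx2' : c * (2 * (‖x‖ * V)) ≤ V * A := by
      calc c * (2 * (‖x‖ * V)) ≤ c * (V * (1 + ‖x‖ ^ 2)) := mul_le_mul_of_nonneg_left hx2 hc0.le
        _ = V * A := by rw [hA]; ring
    have h6 : ν * (6 * c) ≤ 6 * ν * A := by
      have hpos : 0 ≤ ν * c * ‖x‖ ^ 2 := by positivity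
      have e : 6 * ν * A - ν * (6 * c) = 6 * (ν * c * ‖x‖ ^ 2) := by rw [hA]; ring
      linarith
    have e2 : β * A = 6 * ν * A + V * A + A := by rw [hβ]; ring
    have e3 : wₜ t x = σ * Γₜ t x - (F + β * A) := by
      simp only [hwₜ, hA, hc]
    rw [e3]
    linarith
  -- (e) the parabolic boundary: `t = 0`
  have hbot : ∀ x ∈ K, w 0 x ≤ 0 := by
    intro x _
    simp only [hw, mul_zero, Real.exp_zero, mul_one, add_zero]
    have h1 := hσabs (swirl (v 0) x)
    have h2 := hM x
    have h3 : 0 ≤ ε * (1 + ‖x‖ ^ 2) := by positivity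
    linarith
  -- (f) the parabolic boundary: the axis and the sphere `|x| = R`
  have hlat : ∀ t ∈ Icc 0 T, ∀ x ∈ K \ U, w t x ≤ 0 := by
    intro t ht x hx
    have hM0 : 0 ≤ M := (abs_nonneg _).trans (hM 0)
    have hFt : 0 ≤ F * t := mul_nonneg hF0 ht.1
    have hexp1 : 1 ≤ Real.exp (β * t) := Real.one_le_exp (mul_nonneg hβ0 ht.1)
    have hH : ε * (1 + ‖x‖ ^ 2) ≤ ε * Real.exp (β * t) * (1 + ‖x‖ ^ 2) := by
      have : ε * (1 + ‖x‖ ^ 2) * 1 ≤ ε * (1 + ‖x‖ ^ 2) * Real.exp (β * t) :=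
        mul_le_mul_of_nonneg_left hexp1 (by positivity)
      linarith
    have hxK : ‖x‖ ≤ R := mem_closedBall_zero_iff.1 hx.1
    simp only [hw]
    by_cases hax : cylRadius x = 0
    · -- on the axis the swirl vanishes
      rw [swirl_eq_zero_of_cylRadius_eq_zero (v t) hax, mul_zero]
      have : 0 ≤ ε * Real.exp (β * t) * (1 + ‖x‖ ^ 2) := by positivity
      linarith
    · -- on the sphere `|x| = R ≥ 2V/ε`
      have hxR : ‖x‖ = R := by
        have hnot : x ∉ ball (0 : (EuclideanSpace ℝ (Fin 3))) R := fun hb => hx.2 ⟨hb, hax⟩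
        have : R ≤ ‖x‖ := by simpa using hnot
        exact le_antisymm hxK this
      have h1 : σ * swirl (v t) x ≤ 2 * R * V := by
        refine (hσabs _).trans ?_
        calc |swirl (v t) x| ≤ 2 * ‖x‖ * ‖v t x‖ := abs_swirl_le_norm_mul (v t) x
          _ ≤ 2 * R * V := by
            rw [hxR]
            exact mul_le_mul_of_nonneg_left (hV t ht x) (by positivity)
      have h2 : 2 * R * V ≤ ε * (1 + ‖x‖ ^ 2) := by
        rw [hxR]
        have : 2 * V ≤ ε * R := by
          rw [div_le_iff₀ hε] at hR; linarith
        nlinarith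
      linarith
  exact weak_max_principle hKc hUo hUK hc h2 ht hsub hbot hlat

/-- **Maximum principle for the swirl with a force, any `ν ≥ 0`** (KNSS 2009 (1.8)–(1.9) /
Lei–Zhang 2017 (1.4) with the forcing term `r f_θ` kept; for `ν = 0` Kelvin's theorem for the
azimuthal circulation on material circles centred on the axis, with torque): let `(v, q)` be a
classical solution of the system with force `f` and viscosity `ν ≥ 0` on the closed slab
`[0, T] × ℝ³` with bounded (`|v| ≤ V`) axisymmetric velocity and axisymmetric force, and let
`|swirl (f t) x| = |r f_θ(t, x)| ≤ F` on `[0, T] × ℝ³`.  If `|Γ₀| ≤ M` then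
`|Γ(t, x)| = |x₀v₁ − x₁v₀| ≤ M + F t` for all `(t, x) ∈ [0, T] × ℝ³`.
[cite: KochNadirashviliSereginSverak2009, §1 (1.8)–(1.9) (arXiv p. 2)] -/
theorem abs_swirl_le_of_classical_forced {T ν V M F : ℝ}
    {v f : ℝ → (EuclideanSpace ℝ (Fin 3)) → (EuclideanSpace ℝ (Fin 3))}
    {q : ℝ → (EuclideanSpace ℝ (Fin 3)) → ℝ}
    (hν : 0 ≤ ν) (hT : 0 < T) (hcl : IsClassicalNSSolutionOn (Icc 0 T) ν f v q)
    (haxi : ∀ t ∈ Icc 0 T, IsAxisymmetric (v t)) (hfaxi : ∀ t ∈ Icc 0 T, IsAxisymmetric (f t))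
    (hV : ∀ t ∈ Icc 0 T, ∀ x, ‖v t x‖ ≤ V) (hM : ∀ x, |swirl (v 0) x| ≤ M)
    (hF : ∀ t ∈ Icc 0 T, ∀ x, |swirl (f t) x| ≤ F) :
    ∀ t ∈ Icc 0 T, ∀ x, |swirl (v t) x| ≤ M + F * t := by
  intro t ht x
  have h1 := sign_mul_swirl_le_of_classical_forced hν hT hcl haxi hfaxi hV hM hF (Or.inl rfl) t ht x
  have h2 := sign_mul_swirl_le_of_classical_forced hν hT hcl haxi hfaxi hV hM hF (Or.inr rfl) t ht x
  rw [one_mul] at h1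
  rw [neg_one_mul] at h2
  exact abs_le.2 ⟨by linarith, h1⟩

/-- **Maximum principle for the swirl with a force on a half-open lifespan `[0, T)`**: for a
classical solution of the forced system (`ν ≥ 0`) on `[0, T) × ℝ³` which is bounded on every closed
sub-slab `[0, T'] × ℝ³`, `T' < T`, with axisymmetric velocity and force, `|r f_θ| ≤ F` on `[0, T)`
and `|Γ₀| ≤ M`: `|Γ(t, x)| ≤ M + F t` for all `t ∈ [0, T)` and all `x` (the closed-slab statement
`abs_swirl_le_of_classical_forced` on `[0, (t + T)/2]`).
[cite: KochNadirashviliSereginSverak2009, §1 (1.8)–(1.9) (arXiv p. 2)] -/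
theorem abs_swirl_le_of_classical_forced_Ico {T ν M F : ℝ}
    {v f : ℝ → (EuclideanSpace ℝ (Fin 3)) → (EuclideanSpace ℝ (Fin 3))}
    {q : ℝ → (EuclideanSpace ℝ (Fin 3)) → ℝ}
    (hν : 0 ≤ ν) (hcl : IsClassicalNSSolutionOn (Ico 0 T) ν f v q)
    (haxi : ∀ t ∈ Ico 0 T, IsAxisymmetric (v t)) (hfaxi : ∀ t ∈ Ico 0 T, IsAxisymmetric (f t))
    (hbdd : ∀ T' < T, ∃ V : ℝ, ∀ t ∈ Icc 0 T', ∀ x, ‖v t x‖ ≤ V)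
    (hM : ∀ x, |swirl (v 0) x| ≤ M) (hF : ∀ t ∈ Ico 0 T, ∀ x, |swirl (f t) x| ≤ F) :
    ∀ t ∈ Ico 0 T, ∀ x, |swirl (v t) x| ≤ M + F * t := by
  intro t ht x
  set T' : ℝ := (t + T) / 2 with hT'
  have hT'pos : 0 < T' := by rw [hT']; linarith [ht.1, ht.2]
  have hT'T : T' < T := by rw [hT']; linarith [ht.2]
  have htT' : t ≤ T' := by rw [hT']; linarith [ht.2]
  have hsub : Icc 0 T' ⊆ Ico 0 T := fun s hs => ⟨hs.1, hs.2.trans_lt hT'T⟩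
  have hcl' : IsClassicalNSSolutionOn (Icc 0 T') ν f v q :=
    hcl.mono hsub (uniqueDiffOn_Icc hT'pos)
  obtain ⟨V, hV⟩ := hbdd T' hT'T
  exact abs_swirl_le_of_classical_forced hν hT'pos hcl' (fun s hs => haxi s (hsub hs))
    (fun s hs => hfaxi s (hsub hs)) hV hM (fun s hs => hF s (hsub hs)) t ⟨ht.1, htT'⟩ x

end SwirlForced

end Literature.Analysis.FluidPDE

end
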